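import Summits.CriticalPhenomena.CardyFormulaZ2.Theses.DyadicBetaRigidity
import Literature.Probability.RandomPlanarGeometry.CardyFunctionIncBeta

/-!
# Line `shape-free-law` — strategist skeleton for crux `DyadicLatticeBetaLaw` (stmt-CriticalPhenomena-18183)

Route `DyadicBetaRigidity` (rank-2 crux; the route's other crux is `CardyRigidity`, stmt-0746, SHARED
verbatim with CardyUniqueLimit / CardyTensorRG / CardyQContinuation / …).

    DyadicLatticeBetaLaw := ∃ a ∈ (0,1), ∀ h > 0, ∀ lattice polygon R of hℤ², ∀ (φ, x) uniformizing,
        P_{1/2}[R crossed at mesh h/2^k] ⟶ I_a(crossRatio x)   (k → ∞),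
    I_a(η) = ∫₀^η (s(1-s))^{-a} / ∫₀¹ (s(1-s))^{-a}.

THE LEVER (lens `strengthen/weaken`, strategist 2026-08-17).  The beta SHAPE `I_a` asked of the
dyadic limit is never used by the route: its deciding theorem feeds the limit law through
`DyadicBetaSuffices` (all conformal rectangles, all meshes) into `CardyRigidity`, which identifies
ANY all-rectangle crossing kernel with Cardy's `F = I_{2/3}`.  Hence the crux follows from
  (A) the SHAPE-FREE dyadic law — some continuous, duality-symmetric `F : (0,1) → ℝ` is the
      dyadic lattice-polygon crossing limit (strictly weaker than the crux: no one-parameter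
      family, no exponent, no Gaussian-line / BKW boundary-tensor identification);
  (B) the general-`F` glue (the route's `DyadicBetaSuffices`, stmt-18184, with `I_a ↦ F`:
      exact dilation covariance of the G02 discretisation + lattice-polygon approximation at
      prescribed mesh + finite scale cover + Bollobás–Riordan sandwich; provable now — the
      route header records a sorry-free 933-line proof `hasCrossingLimit_of_dyadicLattice`
      for general continuous symmetric `F`, attached to stmt-18184 as evidence);
  (C) `CardyRigidity` — literally the route's rank-3 crux stmt-0746 (`stub_cardyRigidity_iff`);
and the PROVED identity `cardyFunction = I_{2/3}` on `(0,1)` (tree: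
`cardyFunction_eq_incBeta13_div_holds`), with `a := 2/3`.
So the lead of THIS crux should spend nothing on the law's shape: the layer-2 child
`DyadicLimitIsBeta` of the route's two-layer plan (Gaussian-line fixed point + BKW corner tensors)
is absorbed by (C), which the route must close anyway.

Stubs (device D-0027 §3.3: `protected theorem Holds.stub_<name> : <statement> := by sorry` + handle
`def stub_<name> : Prop := type_of% Holds.stub_<name>`); composition `DyadicLatticeBetaLaw_of`
(PROVED, kernel-checked, concludes the route decl BY NAME).

## Disproof used
`Cruxes/DyadicLatticeBetaLaw/Disproof.lean` (seeded by refuter-rattack-stmt-CriticalPhenomena-18183-0,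
2026-08-17T05:04Z, rc 0, 0 sorry) contains NO `_false_without_<H>` theorem, no `-- Targets` and no
`Negative/` lemma — its finding is `dyadicLatticeBetaLaw_of_cardyFormulaZ2` (S → C with `a = 2/3`),
`dyadicLatticeBetaLaw_nonvacuous`, `tendsto_unitSquare_of_dyadicLatticeBetaLaw`, and the note that the
crux carries existence + conformal covariance while `CardyRigidity` carries only the exponent.  This
line is exactly the typed form of that note: stub A drops the exponent/shape, stub C is `CardyRigidity`,
and the composition uses the same tree identity `cardyFunction_eq_incBeta13_div_holds` as the
refuter's `cardyFunction_eq_betaLaw`.  Nothing to honour stub-wise; no stub is an instance of a landed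
negative lemma (none exists).  Negatives index (`ledger negatives --problem CriticalPhenomena`):
NegDegenerateArcs (stmt-0748) is respected — every limit value here is `F(η)` at `η ∈ (0,1)`; the
retired no-go `QuarterTurnResistorLaw` (order-4 real corner schemes give `1/(1+m)`) is not engaged —
no corner scheme, no holomorphic trace identity is asserted by any stub.

## Barriers (`Literature/Barriers/CriticalPhenomena/`)
`EmbeddingModulusUniqueness` — not embedding-blind: (A) is about the true conformal modulus of
lattice polygons of the square embedding, (B) uses the exact dilation covariance of δℤ²;
`SmirnovTriangularOnly`, `CoveringLatticeShift`, `FKParafermionicHalfCauchyRiemann` — no discrete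
holomorphic observable and no lattice rewriting in any stub; `ScaleCovarianceNotMoebius` — no
symmetry-upgrade is claimed: conformal covariance is INSIDE hypothesis (A) (a kernel of the
cross-ratio), exactly as in the crux; `RigorousRGSmallParameterNarrow` — the line is engine-free.
-/

noncomputable section

open MeasureTheory Filter Set Topology
open UpperHalfPlane (upperHalfPlaneSet)
open Literature.Probability.RandomPlanarGeometry Literature.Probability.LatticeModels
open Literature.Probability.Percolation hiding cardyFunction

namespace Summit.CriticalPhenomena.CardyFormulaZ2.Cruxes.DyadicLatticeBetaLaw.ShapeFreeLaw

/-- STUB A — **shape-free dyadic lattice-polygon law** (the crux with the beta family `I_a`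
replaced by an arbitrary continuous, duality-symmetric law `F` on `(0,1)`; the research content of
the line — any engine for the crux (tensor RG at the Δ = −1/2 six-vertex point, Temperley–Lieb
sewing, …) need only deliver THIS).  There is `F : ℝ → ℝ`, continuous on `(0,1)` with
`F(1-η) = 1 - F(η)` there, such that for every mesh `h > 0`, every conformal rectangle `R` whose
frontier is covered by finitely many edges of `hℤ²` (marks anywhere) and every uniformizing datum
`(φ, x)` of `R`, the `P_{1/2}` bond-`ℤ²` crossing probability of `R` at the dyadic meshes `h/2^k`
tends to `F (crossRatio x)` as `k → ∞`. -/
protected theorem Holds.stub_dyadicLawF :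
    ∃ F : ℝ → ℝ, ContinuousOn F (Set.Ioo 0 1) ∧ (∀ η ∈ Set.Ioo (0 : ℝ) 1, F (1 - η) = 1 - F η) ∧
      ∀ h : ℝ, 0 < h → ∀ R : ConformalRectangle,
        (∃ S : Finset (ℂ × ℂ), (∀ p ∈ S, ∃ u v : Site 2, (zdGraph 2).Adj u v ∧
            p.1 = meshPoint h u ∧ p.2 = meshPoint h v) ∧
            frontier R.carrier ⊆ ⋃ p ∈ S, segment ℝ p.1 p.2) →
        ∀ (φ : ConformalEquiv upperHalfPlaneSet R.carrier) (x : Fin 4 → ℝ), R.IsUniformizing φ x →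
          Tendsto (fun k : ℕ => bondDomainCrossingProb R (h / 2 ^ k)) atTop
            (𝓝 (F (crossRatio x))) := by
  sorry

/-- By-name handle of the registered stub `Holds.stub_dyadicLawF` (D-0027 §3.3 device). -/
def stub_dyadicLawF : Prop := type_of% Holds.stub_dyadicLawF

/-- STUB B — **the general-`F` dyadic glue** (`DyadicBetaSuffices` of the route, stmt-18184, with
the beta law replaced by an arbitrary continuous duality-symmetric `F`; Bollobás–Riordan 2006 Ch. 7
sandwich + exact dilation covariance of the G02 discretisation + lattice-polygon approximation at
prescribed mesh + finite scale cover `H_j = H₀(1+θ)^j`; provable now — cf. the tree's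
`RectilinearSuffices_proof` and the oracle-sandwich stubs A/B/D1–D3 it is built on).  If the dyadic
lattice-polygon crossing limits are `F ∘ crossRatio`, then EVERY conformal rectangle has crossing
limit `F` along all real meshes `δ → 0⁺`. -/
protected theorem Holds.stub_dyadicSufficesF :
    ∀ F : ℝ → ℝ, ContinuousOn F (Set.Ioo 0 1) → (∀ η ∈ Set.Ioo (0 : ℝ) 1, F (1 - η) = 1 - F η) →
      (∀ h : ℝ, 0 < h → ∀ R : ConformalRectangle,
        (∃ S : Finset (ℂ × ℂ), (∀ p ∈ S, ∃ u v : Site 2, (zdGraph 2).Adj u v ∧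
            p.1 = meshPoint h u ∧ p.2 = meshPoint h v) ∧
            frontier R.carrier ⊆ ⋃ p ∈ S, segment ℝ p.1 p.2) →
        ∀ (φ : ConformalEquiv upperHalfPlaneSet R.carrier) (x : Fin 4 → ℝ), R.IsUniformizing φ x →
          Tendsto (fun k : ℕ => bondDomainCrossingProb R (h / 2 ^ k)) atTop
            (𝓝 (F (crossRatio x)))) →
      ∀ R : ConformalRectangle, R.HasCrossingLimit (bondDomainCrossingProb R) F := by
  sorry

/-- By-name handle of the registered stub `Holds.stub_dyadicSufficesF` (D-0027 §3.3 device). -/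
def stub_dyadicSufficesF : Prop := type_of% Holds.stub_dyadicSufficesF

/-- STUB C — **Cardy rigidity on `ℤ²`**: VERBATIM the route's rank-3 crux `CardyRigidity`
(stmt-CriticalPhenomena-0746, shared item; see `stub_cardyRigidity_iff`).  If the bond-`ℤ²`
crossing probabilities of all conformal rectangles converge to one function `f` of the cross-ratio,
then `f = cardyFunction` on `(0,1)` (exploration path ⇒ SLE_κ, locality ⇒ κ = 6, SLE₆ ⇒ Cardy;
lines `kappa-free-splitting` / `two-readings` of `Cruxes/CardyRigidity`).  It closes when that item
closes; the lead of THIS crux does not work on it. -/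
protected theorem Holds.stub_cardyRigidity :
    ∀ f : ℝ → ℝ, (∀ R : ConformalRectangle, R.HasCrossingLimit (bondDomainCrossingProb R) f) →
      Set.EqOn f cardyFunction (Set.Ioo 0 1) := by
  sorry

/-- By-name handle of the registered stub `Holds.stub_cardyRigidity` (D-0027 §3.3 device). -/
def stub_cardyRigidity : Prop := type_of% Holds.stub_cardyRigidity

/-- STUB C is, definitionally, the route item `CardyRigidity` (stmt-CriticalPhenomena-0746). -/
theorem stub_cardyRigidity_iff :
    stub_cardyRigidity ↔
      Summit.CriticalPhenomena.CardyFormulaZ2.Theses.DyadicBetaRigidity.CardyRigidity :=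
  Iff.rfl

/-- **Cardy's function is the beta law of exponent `2/3`** on `(0,1)`:
`F(η) = ∫₀^η (s(1-s))^{-2/3} ds / ∫₀¹ (s(1-s))^{-2/3} ds` — the `a = 2/3` member of the crux's
family `I_a` (tree theorem `cardyFunction_eq_incBeta13_div_holds`, Cardy 1992 eq. (8) integrated). -/
theorem cardyFunction_eq_betaLaw {η : ℝ} (hη : η ∈ Set.Ioo (0 : ℝ) 1) :
    cardyFunction η =
      (∫ s in (0 : ℝ)..η, (s * (1 - s)) ^ (-(2 / 3 : ℝ))) /
        ∫ s in (0 : ℝ)..1, (s * (1 - s)) ^ (-(2 / 3 : ℝ)) :=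
  cardyFunction_eq_incBeta13_div_holds η ⟨hη.1.le, hη.2.le⟩

/-- **Composition** (kernel-checked, no `sorry`): STUBS A–C imply the crux `DyadicLatticeBetaLaw`
of route `DyadicBetaRigidity` (stmt-CriticalPhenomena-18183), with the exponent `a := 2/3`. -/
theorem DyadicLatticeBetaLaw_of :
    stub_dyadicLawF → stub_dyadicSufficesF → stub_cardyRigidity →
      Summit.CriticalPhenomena.CardyFormulaZ2.Theses.DyadicBetaRigidity.DyadicLatticeBetaLaw := by
  intro hA hB hC
  dsimp only [stub_dyadicLawF, stub_dyadicSufficesF, stub_cardyRigidity] at hA hB hC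
  -- STUB A: a shape-free dyadic law `F`
  obtain ⟨F, hcont, hsymm, hlaw⟩ := hA
  -- STUB B: every conformal rectangle has crossing limit `F` along all meshes
  have hall : ∀ R : ConformalRectangle, R.HasCrossingLimit (bondDomainCrossingProb R) F :=
    hB F hcont hsymm hlaw
  -- STUB C: `F` is Cardy's function on `(0,1)`
  have hEq : Set.EqOn F cardyFunction (Set.Ioo 0 1) := hC F hall
  refine ⟨2 / 3, ⟨by norm_num, by norm_num⟩, ?_⟩
  intro h hh R hR φ x hφ
  have hη : crossRatio x ∈ Set.Ioo (0 : ℝ) 1 :=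
    ConformalRectangle.crossRatio_mem_Ioo_of_isUniformizing hφ
  have hlim := hlaw h hh R hR φ x hφ
  rw [hEq hη, cardyFunction_eq_betaLaw hη] at hlim
  exact hlim

/-- The composition applied to the three registered stubs: the crux, conditionally on the stubs
(the only `sorry`s of this file are inside `stub_*`). -/
theorem dyadicLatticeBetaLaw_of_stubs :
    Summit.CriticalPhenomena.CardyFormulaZ2.Theses.DyadicBetaRigidity.DyadicLatticeBetaLaw :=
  DyadicLatticeBetaLaw_of Holds.stub_dyadicLawF Holds.stub_dyadicSufficesF Holds.stub_cardyRigidity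

end Summit.CriticalPhenomena.CardyFormulaZ2.Cruxes.DyadicLatticeBetaLaw.ShapeFreeLaw

end
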